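import Summits.QuantumAdvantage.QuantumAdvantage.Theorems.CubicForrelationNearExactIsExactTwelveTypeO929Dead

/-!
# Crux `CubicForrelation.NearExactIsExact` (stmt-QuantumAdvantage-14043) — n = 12, the TYPE-O branch AT the boundary rung `29/32 = 928/1024`:
  the base set is `512, 768, 896, 960, 992`, or `1024` with ZERO excess; `768`, `896`, `1024` only at `Φ = 29/32` exactly

Certificate seat `b2b-cforr-cert` (gen 21).  HONEST FRAMING: kernel-checked STRUCTURE lemmas (standard axioms, no `decide`) for the type-O branch of
the window `[928/1024, 929/1024)` at `n = 12` — the first rung at which every strict inequality of the gen-18…20 machinery becomes an equality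
(HOME/b2b-cforr-cert-g20/PLAN-N12-928.md).  Nothing is closed here; NO new value of `θ₁₂`.  NOT summit progress.

For a type-O side (`W_g = 16u`, some — hence every — `u(x)` odd) of a cubic pair on 12 bits write `d₁ = [⌊u/2⌋ odd]` (affine), `d₂ = [⌊u/4⌋ odd]`
(cubic), `E = {d₁ = d₂}` (the support of the cubic `d₁ ⊕ d₂ ⊕ 1`), `τ = u − 4(−1)^f = τ₀ + 8v` with the base pattern `τ₀ = (−1)^{d₁}(1 − 4·1_E)`,
so that `Σ τ² = 2¹⁷(1 − Φ)` (`tw12_budget`) and `Σ τ² ≥ Σ τ₀² = 4096 + 8·#E` (pointwise `(τ₀ + 8v)² ≥ τ₀²`).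
* `to21_typeO_ge2932_shape` (`Φ ≥ 29/32`): `Σ τ² ≤ 12288`, hence `#E ≤ 1024`; by Kasami–Tokura for cubics on 12 bits (`kt3_weights_twelve`) and
  `E ≠ ∅` (`TypeOTwelve.no_caseA`): `#E ∈ {512, 768, 896, 960, 992}` or `#E = 1024` — and in the last case the budget is exhausted by the base
  pattern: `Σ τ² = 12288`, ZERO excess, `Φ = 29/32` exactly.
* `to21_typeO_E768_eq_2932` / `to21_typeO_E896_eq_2932`: the bases `768` and `896` force `Φ = 29/32` exactly (`to15_typeO_E768_le`,
  `to19_typeO_E896_le_2932` give `Φ ≤ 29/32`).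
* `to21_typeO_E1024_zero_excess`: base `1024` ⇒ pointwise `u − 4(−1)^f = (−1)^{d₁}(1 − 4·1_E)` and `Φ = 29/32`.
* `to21_typeO_window2932_shape`: in the OPEN part `[928/1024, 929/1024)` of the window the same list, with the excess
  `Σ τ² − (4096 + 8·#E)` at most `4096, 2048, 1024, 512, 256, 0` respectively.
So the type-O branch of the rung `928` consists of SIX equality-type configurations (cf. `932`: T1 = base `960` zero excess; `930`: T0 = base
`992` zero excess; `929`: base `512` with one wild point), to be killed one by one in later files.

References: T. Kasami, N. Tokura (1970) Thm 1 (through the tree's `kt3_weights_twelve`); J. Ax (1964) / R. J. McEliece (1972); MacWilliams–Sloane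
(1977) Ch. 15.  Everything below is proved from Mathlib and the tree; axioms are the standard three.
-/

set_option linter.dupNamespace false -- D-0017: single-problem summit ⇒ `QuantumAdvantage.QuantumAdvantage` by design

noncomputable section

namespace Summit.QuantumAdvantage.QuantumAdvantage.Theorems.CubicForrelation.NearExactIsExact

open Finset
open Literature.Computability.QuantumComplexity
open Literature.Computability.QuantumComplexity.BuzetChailloux (bxor zeroVec bxor_bxor_cancel_left bxor_zeroVec zeroVec_bxor bxor_comm
  bxor_self twist_zeroVec_right twist_bxor_right)
open Literature.Computability.QuantumComplexity.DerivativeWalsh (W)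
open Summit.QuantumAdvantage.QuantumAdvantage.Theorems.NearExactIsExact.Negative (TypeOTwelve.typeO_of_exists_odd TypeOTwelve.no_caseA)

/-- **Shape of a type-O side at `Φ ≥ 29/32`.**  Cubic `f, g` on 12 bits with `W_g = 16u`, some `u(x)` odd, `Φ(f,g) ≥ 29/32`: the base set
`E = {[⌊u/2⌋ odd] = [⌊u/4⌋ odd]}` has `512, 768, 896, 960` or `992` points, or exactly `1024` points with the budget exhausted by the base pattern
(`Σ (u − 4(−1)^f)² = 12288 = 4096 + 8·1024`); moreover `4096 + 8·#E ≤ Σ (u − 4(−1)^f)² = 2¹⁷(1 − Φ) ≤ 12288`.  (Kasami–Tokura for cubics,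
`kt3_weights_twelve`, applied to the cubic `d₁ ⊕ d₂ ⊕ 1` with support `E`; `E ≠ ∅` by `TypeOTwelve.no_caseA`.)  The shape lemma of the boundary
rung `29/32`; NOT summit progress. [this work] -/
theorem to21_typeO_ge2932_shape (f g : (Fin (6 + 6) → Bool) → Bool) (hg : IsDegLeFun 3 g)
    (u : (Fin (6 + 6) → Bool) → ℤ) (hu : ∀ x, W (fun y => signOf (g y)) x = (2 : ℝ) ^ 4 * (u x : ℝ))
    (hodd : ∃ x, Odd (u x)) (hΦ : (29 / 32 : ℝ) ≤ forrelation f g) :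
    (#(univ.filter fun x : Fin (6 + 6) → Bool => (Odd (u x / 2) ↔ Odd (u x / 2 / 2))) = 512 ∨
      #(univ.filter fun x : Fin (6 + 6) → Bool => (Odd (u x / 2) ↔ Odd (u x / 2 / 2))) = 768 ∨
      #(univ.filter fun x : Fin (6 + 6) → Bool => (Odd (u x / 2) ↔ Odd (u x / 2 / 2))) = 896 ∨
      #(univ.filter fun x : Fin (6 + 6) → Bool => (Odd (u x / 2) ↔ Odd (u x / 2 / 2))) = 960 ∨
      #(univ.filter fun x : Fin (6 + 6) → Bool => (Odd (u x / 2) ↔ Odd (u x / 2 / 2))) = 992 ∨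
      (#(univ.filter fun x : Fin (6 + 6) → Bool => (Odd (u x / 2) ↔ Odd (u x / 2 / 2))) = 1024 ∧
        (∑ x, (u x - 4 * sZ (f x)) ^ 2 : ℤ) = 12288)) ∧
    4096 + 8 * (#(univ.filter fun x : Fin (6 + 6) → Bool => (Odd (u x / 2) ↔ Odd (u x / 2 / 2))) : ℤ) ≤
      (∑ x, (u x - 4 * sZ (f x)) ^ 2 : ℤ) ∧
    (∑ x, (u x - 4 * sZ (f x)) ^ 2 : ℤ) ≤ 12288 ∧
    ((∑ x, (u x - 4 * sZ (f x)) ^ 2 : ℤ) : ℝ) = (2 : ℝ) ^ 17 * (1 - forrelation f g) := by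
  classical
  have hall : ∀ x, Odd (u x) := TypeOTwelve.typeO_of_exists_odd g u hg hu hodd
  have hu' : ∀ x, W (fun y => signOf (g y)) x = (2 : ℝ) ^ (2 * 2) * (u x : ℝ) := fun x => (hu x).trans (by norm_num)
  have hd1 : IsDegLeFun 1 (fun x => decide (Odd (u x / 2))) := z2_digitOne 2 g u hg hu' hall
  have hd2 : IsDegLeFun 3 (fun x => decide (Odd (u x / 2 / 2))) := z2_digitTwo 2 g u hg hu' hall
  set E := univ.filter (fun x : Fin (6 + 6) → Bool => (Odd (u x / 2) ↔ Odd (u x / 2 / 2))) with hEdef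
  have hdegE : IsDegLeFun (2 + 1) (fun x => (decide (Odd (u x / 2)) ^^ decide (Odd (u x / 2 / 2))) ^^ true) :=
    tb_isDegLeFun_xor_const (bb_isDegLeFun_bxor (hd1.mono (by norm_num)) hd2) true
  have hsetE : (univ.filter fun x : Fin (6 + 6) → Bool =>
      ((decide (Odd (u x / 2)) ^^ decide (Odd (u x / 2 / 2))) ^^ true) = true) = E := by
    rw [hEdef]
    apply filter_congr
    intro x _
    by_cases h1 : Odd (u x / 2) <;> by_cases h2 : Odd (u x / 2 / 2) <;> simp [h1, h2]
  have hsumE : (∑ x, (if (Odd (u x / 2) ↔ Odd (u x / 2 / 2)) then 1 else 0 : ℤ)) = #E := by rw [sum_boole]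
  -- `E ≠ ∅` (case A is empty)
  have hEpos : 0 < #E := by
    by_contra h0
    have hE0 : #E = 0 := by omega
    refine TypeOTwelve.no_caseA g u hg hu fun x => ?_
    have hx : x ∉ E := by rw [card_eq_zero] at hE0; rw [hE0]; exact notMem_empty x
    rw [hEdef, mem_filter] at hx
    have h0 := Int.odd_iff.1 (hall x)
    have hx' : ¬ (Odd (u x / 2) ↔ Odd (u x / 2 / 2)) := fun h => hx ⟨mem_univ _, h⟩
    rw [Int.odd_iff, Int.odd_iff] at hx'
    omega
  -- budget: `4096 + 8#E ≤ Σ τ² = 2¹⁷(1 − Φ) ≤ 12288`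
  have hbud := tw12_budget f g u hu
  have hT : (∑ x, (u x - 4 * sZ (f x)) ^ 2 : ℤ) ≤ 12288 := by
    have h' : ((∑ x, (u x - 4 * sZ (f x)) ^ 2 : ℤ) : ℝ) ≤ 12288 := by rw [hbud]; linarith
    exact_mod_cast h'
  choose v hv using fun x => to12_pt_mod8 (u x) (sZ (f x)) (hall x) (tp_sZ_cases (f x))
  set τ₀ : (Fin (6 + 6) → Bool) → ℤ := fun x =>
    sZ (decide (Odd (u x / 2))) * (1 - 4 * (if (Odd (u x / 2) ↔ Odd (u x / 2 / 2)) then 1 else 0)) with hτ₀def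
  have hτ₀val : ∀ x, τ₀ x = 1 ∨ τ₀ x = -1 ∨ τ₀ x = 3 ∨ τ₀ x = -3 := by
    intro x
    simp only [τ₀]
    rcases tp_sZ_cases (decide (Odd (u x / 2))) with h | h <;> rw [h] <;> split_ifs <;> norm_num
  have hτ₀sq : ∀ x, τ₀ x ^ 2 = 1 + 8 * (if (Odd (u x / 2) ↔ Odd (u x / 2 / 2)) then 1 else 0 : ℤ) := by
    intro x
    simp only [τ₀]
    rcases tp_sZ_cases (decide (Odd (u x / 2))) with h | h <;> rw [h] <;> split_ifs <;> norm_num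
  have hsumτ₀ : ∑ x, τ₀ x ^ 2 = 4096 + 8 * #E := by
    rw [sum_congr rfl fun x _ => hτ₀sq x, sum_add_distrib, ← mul_sum, hsumE, sum_const, card_univ, Fintype.card_fun,
      Fintype.card_bool, Fintype.card_fin]
    norm_num
  have hTge : ∑ x, τ₀ x ^ 2 ≤ (∑ x, (u x - 4 * sZ (f x)) ^ 2 : ℤ) := by
    refine sum_le_sum fun x _ => ?_
    rw [hv x]
    linarith [to12_excess_nonneg (τ₀ x) (v x) (hτ₀val x)]
  rw [hsumτ₀] at hTge
  have hE1024 : #E ≤ 1024 := by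
    have : (8 : ℤ) * #E ≤ 8192 := by linarith
    have : 8 * #E ≤ 8192 := by exact_mod_cast this
    omega
  refine ⟨?_, hTge, hT, hbud⟩
  rcases Nat.lt_or_ge #E 1024 with hlt | hge
  · -- Kasami–Tokura for cubics on 12 bits: `#E ∈ {0, 512, 768, 896, 960, 992}`
    have hKT := kt3_weights_twelve _ hdegE (by rw [hsetE]; exact hlt)
    rw [hsetE] at hKT
    rcases hKT with h | h | h | h | h | h
    · omega
    · exact Or.inl h
    · exact Or.inr (Or.inl h)
    · exact Or.inr (Or.inr (Or.inl h))
    · exact Or.inr (Or.inr (Or.inr (Or.inl h)))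
    · exact Or.inr (Or.inr (Or.inr (Or.inr (Or.inl h))))
  · -- `#E = 1024` exhausts the budget
    have h1024 : #E = 1024 := le_antisymm hE1024 hge
    right; right; right; right; right
    refine ⟨h1024, le_antisymm hT ?_⟩
    rw [h1024] at hTge
    push_cast at hTge
    linarith

/-- **Base `768` at `Φ ≥ 29/32` forces `Φ = 29/32` exactly** (`to15_typeO_E768_le` gives `Φ ≤ 29/32`).  NOT summit progress. [this work] -/
theorem to21_typeO_E768_eq_2932 (f g : (Fin (6 + 6) → Bool) → Bool) (hf : IsDegLeFun 3 f) (hg : IsDegLeFun 3 g)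
    (u : (Fin (6 + 6) → Bool) → ℤ) (hu : ∀ x, W (fun y => signOf (g y)) x = (2 : ℝ) ^ 4 * (u x : ℝ))
    (hodd : ∃ x, Odd (u x)) (hE : #(univ.filter fun x : Fin (6 + 6) → Bool => (Odd (u x / 2) ↔ Odd (u x / 2 / 2))) = 768)
    (hΦ : (29 / 32 : ℝ) ≤ forrelation f g) : forrelation f g = 29 / 32 :=
  le_antisymm (to15_typeO_E768_le f g hf hg u hu hodd hE) hΦ

/-- **Base `896` at `Φ ≥ 29/32` forces `Φ = 29/32` exactly** (`to19_typeO_E896_le_2932` gives `Φ ≤ 29/32`).  NOT summit progress.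
[this work] -/
theorem to21_typeO_E896_eq_2932 (f g : (Fin (6 + 6) → Bool) → Bool) (hf : IsDegLeFun 3 f) (hg : IsDegLeFun 3 g)
    (u : (Fin (6 + 6) → Bool) → ℤ) (hu : ∀ x, W (fun y => signOf (g y)) x = (2 : ℝ) ^ 4 * (u x : ℝ))
    (hodd : ∃ x, Odd (u x)) (hE : #(univ.filter fun x : Fin (6 + 6) → Bool => (Odd (u x / 2) ↔ Odd (u x / 2 / 2))) = 896)
    (hΦ : (29 / 32 : ℝ) ≤ forrelation f g) : forrelation f g = 29 / 32 :=
  le_antisymm (to19_typeO_E896_le_2932 f g hf hg u hu hodd hE) hΦ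

/-- **Base `1024`: zero excess and `Φ = 29/32`.**  Cubic `f, g` on 12 bits, `W_g = 16u`, some `u(x)` odd, `Φ ≥ 29/32`, `#E = 1024`: then
`Σ (u − 4(−1)^f)² = 12288`, pointwise `u − 4(−1)^f = (−1)^{d₁}(1 − 4·1_E)` (no wild point), and `Φ = 29/32`.  The analogue, one base up, of
gen 18's `T1` (base `960` at `932/1024`) and gen 19/20's `T0` (base `992` at `930/1024`).  NOT summit progress. [this work] -/
theorem to21_typeO_E1024_zero_excess (f g : (Fin (6 + 6) → Bool) → Bool) (hg : IsDegLeFun 3 g)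
    (u : (Fin (6 + 6) → Bool) → ℤ) (hu : ∀ x, W (fun y => signOf (g y)) x = (2 : ℝ) ^ 4 * (u x : ℝ))
    (hodd : ∃ x, Odd (u x)) (hE : #(univ.filter fun x : Fin (6 + 6) → Bool => (Odd (u x / 2) ↔ Odd (u x / 2 / 2))) = 1024)
    (hΦ : (29 / 32 : ℝ) ≤ forrelation f g) :
    (∑ x, (u x - 4 * sZ (f x)) ^ 2 : ℤ) = 12288 ∧
    (∀ x, u x - 4 * sZ (f x) = sZ (decide (Odd (u x / 2))) * (1 - 4 * (if (Odd (u x / 2) ↔ Odd (u x / 2 / 2)) then 1 else 0))) ∧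
    forrelation f g = 29 / 32 := by
  classical
  obtain ⟨hshape, hge, hle, hbud⟩ := to21_typeO_ge2932_shape f g hg u hu hodd hΦ
  have hT : (∑ x, (u x - 4 * sZ (f x)) ^ 2 : ℤ) = 12288 := by
    rcases hshape with h | h | h | h | h | ⟨-, hT⟩
    · omega
    · omega
    · omega
    · omega
    · omega
    · exact hT
  have hΦeq : forrelation f g = 29 / 32 := by
    have h1 : ((∑ x, (u x - 4 * sZ (f x)) ^ 2 : ℤ) : ℝ) = 12288 := by exact_mod_cast hT
    rw [hbud] at h1
    linarith
  refine ⟨hT, ?_, hΦeq⟩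
  -- pointwise: the excess `Σ ((τ₀ + 8v)² − τ₀²) = 0` with non-negative terms
  have hall : ∀ x, Odd (u x) := TypeOTwelve.typeO_of_exists_odd g u hg hu hodd
  set E := univ.filter (fun x : Fin (6 + 6) → Bool => (Odd (u x / 2) ↔ Odd (u x / 2 / 2))) with hEdef
  have hsumE : (∑ x, (if (Odd (u x / 2) ↔ Odd (u x / 2 / 2)) then 1 else 0 : ℤ)) = #E := by rw [sum_boole]
  choose v hv using fun x => to12_pt_mod8 (u x) (sZ (f x)) (hall x) (tp_sZ_cases (f x))
  set τ₀ : (Fin (6 + 6) → Bool) → ℤ := fun x =>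
    sZ (decide (Odd (u x / 2))) * (1 - 4 * (if (Odd (u x / 2) ↔ Odd (u x / 2 / 2)) then 1 else 0)) with hτ₀def
  have hτ₀val : ∀ x, τ₀ x = 1 ∨ τ₀ x = -1 ∨ τ₀ x = 3 ∨ τ₀ x = -3 := by
    intro x
    simp only [τ₀]
    rcases tp_sZ_cases (decide (Odd (u x / 2))) with h | h <;> rw [h] <;> split_ifs <;> norm_num
  have hτ₀sq : ∀ x, τ₀ x ^ 2 = 1 + 8 * (if (Odd (u x / 2) ↔ Odd (u x / 2 / 2)) then 1 else 0 : ℤ) := by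
    intro x
    simp only [τ₀]
    rcases tp_sZ_cases (decide (Odd (u x / 2))) with h | h <;> rw [h] <;> split_ifs <;> norm_num
  have hsumτ₀ : ∑ x, τ₀ x ^ 2 = 12288 := by
    rw [sum_congr rfl fun x _ => hτ₀sq x, sum_add_distrib, ← mul_sum, hsumE, sum_const, card_univ, Fintype.card_fun,
      Fintype.card_bool, Fintype.card_fin]
    change (4096 : ℕ) • (1 : ℤ) + 8 * ((#E : ℕ) : ℤ) = 12288
    rw [hE]; norm_num
  have hXnn : ∀ x, 0 ≤ (τ₀ x + 8 * v x) ^ 2 - τ₀ x ^ 2 := fun x => to12_excess_nonneg _ _ (hτ₀val x)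
  have hTdec : (∑ x, (u x - 4 * sZ (f x)) ^ 2 : ℤ) = ∑ x, τ₀ x ^ 2 + ∑ x, ((τ₀ x + 8 * v x) ^ 2 - τ₀ x ^ 2) := by
    rw [← sum_add_distrib]
    exact sum_congr rfl fun x _ => by rw [hv x]; ring
  have hXsum0 : ∑ x, ((τ₀ x + 8 * v x) ^ 2 - τ₀ x ^ 2) = 0 := by
    apply le_antisymm _ (sum_nonneg fun x _ => hXnn x)
    linarith
  have hX0 : ∀ x, (τ₀ x + 8 * v x) ^ 2 - τ₀ x ^ 2 = 0 := fun x =>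
    (sum_eq_zero_iff_of_nonneg fun y _ => hXnn y).1 hXsum0 x (mem_univ x)
  intro x
  have hv0 : v x = 0 := by
    by_contra hne
    have h1 : 1 ≤ v x ∨ v x ≤ -1 := by omega
    have h2 := to12_excess _ _ 1 (hτ₀val x) le_rfl h1
    have h3 := hX0 x
    linarith
  rw [hv x, hv0]; ring

/-- **Shape in the open part of the window, `29/32 ≤ Φ < 929/1024`** (the 16 grid values `k/16384`, `14848 ≤ k ≤ 14863`, left open by
`…TwelveClosed929`): the base set is `512, 768, 896, 960, 992` or `1024`, the excess `X = Σ (u − 4(−1)^f)² − (4096 + 8·#E)` over the base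
pattern satisfies `X ≤ 8192 − 8·#E` (so `≤ 4096, 2048, 1024, 512, 256, 0`), and `X > 8064 − 8·#E` (the window is below `929/1024`:
`Σ τ² > 12160`).  In particular base `992` carries `128 < X ≤ 256` and base `1024` is the zero-excess configuration at `Φ = 29/32`.
NOT summit progress. [this work] -/
theorem to21_typeO_window2932_shape (f g : (Fin (6 + 6) → Bool) → Bool) (hg : IsDegLeFun 3 g)
    (u : (Fin (6 + 6) → Bool) → ℤ) (hu : ∀ x, W (fun y => signOf (g y)) x = (2 : ℝ) ^ 4 * (u x : ℝ))
    (hodd : ∃ x, Odd (u x)) (hΦ : (29 / 32 : ℝ) ≤ forrelation f g) (hhi : forrelation f g < 929 / 1024) :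
    (#(univ.filter fun x : Fin (6 + 6) → Bool => (Odd (u x / 2) ↔ Odd (u x / 2 / 2))) = 512 ∨
      #(univ.filter fun x : Fin (6 + 6) → Bool => (Odd (u x / 2) ↔ Odd (u x / 2 / 2))) = 768 ∨
      #(univ.filter fun x : Fin (6 + 6) → Bool => (Odd (u x / 2) ↔ Odd (u x / 2 / 2))) = 896 ∨
      #(univ.filter fun x : Fin (6 + 6) → Bool => (Odd (u x / 2) ↔ Odd (u x / 2 / 2))) = 960 ∨
      #(univ.filter fun x : Fin (6 + 6) → Bool => (Odd (u x / 2) ↔ Odd (u x / 2 / 2))) = 992 ∨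
      #(univ.filter fun x : Fin (6 + 6) → Bool => (Odd (u x / 2) ↔ Odd (u x / 2 / 2))) = 1024) ∧
    4096 + 8 * (#(univ.filter fun x : Fin (6 + 6) → Bool => (Odd (u x / 2) ↔ Odd (u x / 2 / 2))) : ℤ) ≤
      (∑ x, (u x - 4 * sZ (f x)) ^ 2 : ℤ) ∧
    (∑ x, (u x - 4 * sZ (f x)) ^ 2 : ℤ) ≤ 12288 ∧
    12160 < (∑ x, (u x - 4 * sZ (f x)) ^ 2 : ℤ) := by
  obtain ⟨hshape, hge, hle, hbud⟩ := to21_typeO_ge2932_shape f g hg u hu hodd hΦ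
  refine ⟨?_, hge, hle, ?_⟩
  · rcases hshape with h | h | h | h | h | ⟨h, -⟩
    · exact Or.inl h
    · exact Or.inr (Or.inl h)
    · exact Or.inr (Or.inr (Or.inl h))
    · exact Or.inr (Or.inr (Or.inr (Or.inl h)))
    · exact Or.inr (Or.inr (Or.inr (Or.inr (Or.inl h))))
    · exact Or.inr (Or.inr (Or.inr (Or.inr (Or.inr h))))
  · have h' : (12160 : ℝ) < ((∑ x, (u x - 4 * sZ (f x)) ^ 2 : ℤ) : ℝ) := by rw [hbud]; linarith
    exact_mod_cast h'

end Summit.QuantumAdvantage.QuantumAdvantage.Theorems.CubicForrelation.NearExactIsExact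

end
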